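import Summits.QuantumFields.YangMills.Theorems.BalabanUVNodesN15FullPropagatorV1XSized
import Summits.QuantumFields.YangMills.Theorems.BalabanUVNodesN15SizedKnitSocket

/-!
# Route «BalabanUVNodes», cluster K4 «SpineRates» — node N15 = NE2, -a lane, part 86 (programme S, file S-E): THE SIZED KNIT SOCKET APPLIED TO dag-n15-c's SIZED
# GAUGE-DRESSED FAMILIES (FILE 40 `fgInstanceV1GS` ∕ `fgFamilyV1XS` ∕ `…V1XCS` ∕ `…V1XAS`) — `N15At ∧ PairedFamilyGuard.Live` for a family whose operator layer reads a
# LIVE gauge field `A′` through Bałaban's (3.52) species AND whose [B9] size `M` is live SUBSTANTIVELY (the (3.35) window `C·M·α₀`)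

Cell `pub-ymgap`, seat `pub-ymgap-dag-n15-a` (-a KNIT-BY-NAME seat of node N15; HUMAN RULING D-0062; chair R424 venue), generation 18, part 86 (three data `def`s — two re-based kernel
families and one `NE2Objects₁₁` literal —, the rest theorems; 0 `sorry`).  `bears_on: R4∕N15 · K3⁷ SpineGivenEndpointR13SepCoPH (stmt-QuantumFields-20544)`.  Filed `--kind proof
--supports stmt-QuantumFields-20544 --as helper` — COUNT-NEUTRAL.  Imports dag-n15-c FILE 40 `…N15FullPropagatorV1XSized` (p-id on the bus; `fgInstanceV1GS`, `fgFamilyV1XS`∕`V1XCS`∕`V1XAS`,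
`ne2PlusOperator_fullGM₂_v1XS`∕`…v1XCS`∕`…v1XAS`, `reg335_fgInstanceV1GS_const`) and part 85 (S-D `…N15SizedKnitSocket`: `geoS`, `siteOnS`, `covOnS`, `n15At_opGeoS_of_ne2PlusOperator`,
`live_opGeoS`, `cofinal_fst_tgIndexS`); nothing in the tree is modified.  ONE APPLICATION of the socket per family (pattern part 79 ∕ 81 ∕ V-D).

WHY.  Programme S made the -a lane's genuine `U ≡ 1` family size-live (S-A…S-C) and built the socket (S-D) for background-LIVE producers; dag-n15-c's FILE 40 is the first
producer: Bałaban's full `U ≡ 1` Landau-gauge propagator `⊗ 1_𝔤` on the torus family of record dressed by his (3.52) species `V′₁(A′)` of a LIVE gauge field (exact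
coefficients, covariant entries in the `V1XC`∕`V1XA` editions), on this seat's SIZED carrier `unitTorusGeoS … j.Msz` with the (3.35) window read at size `M` (`C·M·α₀`,
`reg335_fgInstanceV1GS_iff`) — so the printed-template `NE2PlusOperator` there is NOT obtainable from a bounded-`M` witness (`not_exists_gf_M_lt_fgInstanceV1GS`,
`exists_not_ne2PlusOperator_fgInstanceV1GS`).  Its coarse carrier `opGeo (unitTorusGeoS …) ((Tor × Fin (d+1)) × ι) (liftBlk blkFine ι)` IS the socket's `opGeo (geoS …) (X j) (blk j)` at
`ι := (·.1.toTGIndex)`, `Mc := (·.1.Msz)` LITERALLY (`geoS` unfolds to `unitTorusGeoS`), so the knit is immediate.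

WHAT.  §1 defs `v1SiteS`, `v1CovS` (the socket's re-based genuine `U ≡ 1` site ∕ (2.156) unit kernels on FILE 40's carrier), `reg_zero_fgInstanceV1GS` (the trivial field `A′ = 0` is
(3.35)∕(3.36)-regular at every `α₀ > 0`, `c₃₅ ≥ 0` — FILE 40's `reg335_fgInstanceV1GS_const` at `a := 0`); §2 ★★★ `n15At_v1XS` ∕ `n15At_v1XCS` ∕ `n15At_v1XAS` — `N15At ⟨TGIndexS × Fin (d+1),
c₃₅, p, fgInstanceV1GS, fgFamily…S b, v1SiteS a_S, v1CovS α β, ⊤, dist⟩` OUTRIGHT (`d ≥ 1`, odd `L ≥ 3`, `b, a_S, c₃₅ > 0`) — operator layer = n15-c's theorem BY NAME, site∕unit = the socket;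
§3 ★★ `live_fgInstanceV1GS` (w2's `Live` for ANY kernels on FILE 40's carrier: `cofinal_fst_tgIndexS` + §1's regularity), ★★★ `live_and_n15At_v1XAS` (guard ∧ estimate — the best
N15 inhabitant in the tree: operator layer background-LIVE and size-LIVE substantively, all four entries covariant); §4 def `v1XASObjects : NE2Objects₁₁` (RR-1's container) +
`n15At_∕live_∕populated_v1XASObjects`, keyed faces `s_N15_of_admits_v1XAS(_family)` (`d + 1 = 4`, the datum's own block factor), `live_and_n15At_v1XASObjects_family`.  The CoPH
faces and the keyed-live reading (pattern S-B §3 ∕ S-C §3–§4) are the companion S-F.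

HONEST FRAMING.  Kernel composition BY NAME (FILE 40 + S-D); no estimate here.  WHAT THE FAMILY IS: operator layer = dag-n15-c's MODEL-LEVEL species reading (abelianised∕matrix
`V′₁(A′)` to the order FILE 28∕30 keep, block-mean coarse partner; GENUINE full `U ≡ 1` propagator; the background `A′` LIVE through the (3.35) window at size `M`); site ∕ unit
layers = the `U ≡ 1` objects re-based (U-BLIND — said; the U-seeing exact (2.156) unit layer of programme V for coloured carriers is the located «V-H», not done); Bałaban's
size `M` is live substantively in the operator layer's window and formally in the U-blind layers.  NOT Bałaban's multiscale `G(U)` of [B9] Thm 3.3 at a general (3.35)-regular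
`U` (NE2⁺ proper — NOT PRINTED as an η-rate), NOT Node 00's [B9] operator layer of record (the pin of `𝔯.lit·ne2` remains the definers' ∕ the plan's) — so **N15 is NOT discharged**
(typed 28∕28 · discharged 5∕27 of record unchanged); K3⁷ OPEN; count-neutral; one finite four-torus programme at fixed `ε` — NOT ℝ⁴, NOT infinite volume, NOT OS, NOT a mass gap,
NOT Clay.  Restate-immune (no Theses import).
-/

set_option autoImplicit false

noncomputable section
namespace Summit.QuantumFields.YangMills.BalabanUVNodes.N15.GenuineRecord

open Literature.MathematicalPhysics.QuantumFieldTheory.Balaban1983to89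
open Literature.MathematicalPhysics.QuantumFieldTheory.Balaban1983to89.T4Continuum (T4Family ULoop)
open Literature.MathematicalPhysics.QuantumFieldTheory.Balaban1983to89.T4EtaRate (EtaPairing PairedInstance NE2PlusOperator NE2PlusSite NE2PlusUnit)
open Literature.MathematicalPhysics.QuantumFieldTheory.Balaban1983to89.B5Prop11Plancherel (Tor fine)
open Node00 (NE2Objects₁₁)
open Summit.QuantumFields.BalabanUV.T4Continuum.HistoryFlow (two_le_L)
open Summit.QuantumFields.YangMills.BalabanUVNodes.N15.OperatorReadout (opGeo)
open Summit.QuantumFields.YangMills.BalabanUVNodes.N15.MatrixSpecies (liftBlk)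
open Summit.QuantumFields.YangMills.BalabanUVNodes.N15.TwoGrid (TGIndex)
open Summit.QuantumFields.YangMills.BalabanUVNodes.N15.VectorPiece (blkFine)
open Summit.QuantumFields.YangMills.BalabanUVNodes.N15.BackgroundLayer (fgInstanceV1GS fgFamilyV1XS fgFamilyV1XCS fgFamilyV1XAS ne2PlusOperator_fullGM₂_v1XS
  ne2PlusOperator_fullGM₂_v1XCS ne2PlusOperator_fullGM₂_v1XAS reg335_fgInstanceV1GS_const)
open Summit.QuantumFields.YangMills.BalabanUVNodes.N15.AtKeyedHome (s_N15_of_admits neZero_blockFactor)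
open Summit.QuantumFields.YangMills.BalabanUVNodes.N15.PairedFamilyGuard (Live)
open YMDAG.UVSplit (Datum NE2Carriers RateCarriers RateRecordPred N15At S_N15 ne2OfRecord₁₁)

variable {L : ℕ} [NeZero L]
variable (d : ℕ) (𝔄 : Type) [NormedRing 𝔄] [NormedAlgebra ℝ 𝔄] [CompleteSpace 𝔄] (ι : Type) [Fintype ι] [DecidableEq ι] [Nonempty ι] (e : 𝔄 ≃L[ℝ] (ι → ℝ))

/-! ## §1 The socket data at FILE 40's carrier: argument lattices, blocks, the two re-based kernels, regularity of the trivial field -/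

/-- THE GENUINE `U ≡ 1` SITE KERNEL `𝔇((Q′G′²Q′*)⁻¹)` re-based on FILE 40's sized gauge-dressed carrier (the socket's `siteOnS` at `ι := (·.1.toTGIndex)`, `Mc := (·.1.Msz)`, coloured
1-form arguments `(Tor × Fin (d+1)) × ι`, blocks `liftBlk blkFine ι`, background carrier = FILE 40's fine `v1GaugeBg` at size `M`; U-blind). [cite: Balaban1985BackgroundPropagators, Thm 3.2 (3.48) p.398 (the kernel, shape)] -/
def v1SiteS (hL : Odd L ∧ 1 < L) (aS : ℝ) (j : TGIndexS × Fin (d + 1)) : B9.SiteKernel (fgInstanceV1GS d 𝔄 ι hL j).gc (fgInstanceV1GS d 𝔄 ι hL j).Bf :=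
  siteOnS d hL aS (fun j : TGIndexS × Fin (d + 1) => j.1.toTGIndex) (fun j => j.1.Msz)
    (fun j => (Tor (fine (L ^ j.1.k) (TGIndex.Mn d hL j.1.toTGIndex)) × Fin (d + 1)) × ι)
    (fun j => liftBlk (blkFine L j.1.k (TGIndex.Mn d hL j.1.toTGIndex)) ι) (fun j => (fgInstanceV1GS d 𝔄 ι hL j).Bf) j

/-- THE (2.156) UNIT-LATTICE COVARIANCE DIFFERENCE re-based likewise (the socket's `covOnS`; U-blind). [cite: Balaban1984PropagatorsII, (2.156) p.250 (object); Balaban1985BackgroundPropagators, Thm 3.15 (3.187) p.432 (shape)] -/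
def v1CovS (hL : Odd L ∧ 1 < L) (α β : Fin (d + 1)) (j : TGIndexS × Fin (d + 1)) : B9.SiteKernel (fgInstanceV1GS d 𝔄 ι hL j).gc (fgInstanceV1GS d 𝔄 ι hL j).Bf :=
  covOnS d hL α β (fun j : TGIndexS × Fin (d + 1) => j.1.toTGIndex) (fun j => j.1.Msz)
    (fun j => (Tor (fine (L ^ j.1.k) (TGIndex.Mn d hL j.1.toTGIndex)) × Fin (d + 1)) × ι)
    (fun j => liftBlk (blkFine L j.1.k (TGIndex.Mn d hL j.1.toTGIndex)) ι) (fun j => (fgInstanceV1GS d 𝔄 ι hL j).Bf) j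

omit [CompleteSpace 𝔄] [DecidableEq ι] [Nonempty ι] in
/-- **THE TRIVIAL GAUGE FIELD `A′ = 0` IS (3.35)- AND (3.36)-REGULAR AT EVERY `α₀ > 0` on FILE 40's fine carrier (`c₃₅ ≥ 0`)** — w2's `Live.reg_one` clause for this family
(FILE 40 `reg335_fgInstanceV1GS_const` at the constant field `a := 0`; the carrier's (3.36) slot repeats the (3.35) letters). [cite: Balaban1985BackgroundPropagators, (3.35)–(3.36) p.396 (shape)] -/
theorem reg_zero_fgInstanceV1GS (hL : Odd L ∧ 1 < L) {c35 : ℝ} (hc35 : 0 ≤ c35) (j : TGIndexS × Fin (d + 1)) (α₀ : ℝ) (hα₀ : 0 < α₀) :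
    (fgInstanceV1GS d 𝔄 ι hL j).Bf.Reg335 c35 α₀ (fgInstanceV1GS d 𝔄 ι hL j).Bf.one ∧ (fgInstanceV1GS d 𝔄 ι hL j).Bf.Reg336 c35 α₀ (fgInstanceV1GS d 𝔄 ι hL j).Bf.one := by
  have h := reg335_fgInstanceV1GS_const d 𝔄 ι hL j hc35 hα₀.le (0 : 𝔄)
    (by rw [norm_zero]; exact mul_nonneg hc35 (mul_nonneg (le_trans zero_le_one j.1.one_le_Msz) hα₀.le))
  exact ⟨h, h⟩

/-! ## §2 ★★★ `N15At` for the three sized gauge-dressed families — one application of the socket each -/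

section Knit

variable {d}

/-- ★★★ **`N15At` — ALL THREE CONJUNCTS BY NAME, OUTRIGHT — FOR dag-n15-c's SIZED GAUGE-DRESSED FAMILY `v1X`** (`d ≥ 1`, odd `L ≥ 3`, `b, a_S, c₃₅ > 0`, every `α β p`): OPERATOR =
FILE 40 `ne2PlusOperator_fullGM₂_v1XS` (Bałaban's full `U ≡ 1` propagator `⊗ 1_𝔤` dressed by the exact-coefficient (3.52) species of a LIVE gauge field, (3.35) window at size `M`),
SITE = G1's `(Q′G′²Q′*)⁻¹` re-based, UNIT = [B6] (2.156) re-based (both U-blind — said) — through the socket `n15At_opGeoS_of_ne2PlusOperator`. [bookkeeping] -/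
theorem n15At_v1XS (hd : 1 ≤ d) (hLodd : Odd L) (hL2 : 2 ≤ L) (hL : Odd L ∧ 1 < L) {b aS c35 : ℝ} (hb : 0 < b) (haS : 0 < aS) (hc35 : 0 < c35)
    (α β : Fin (d + 1)) (p : ℝ) :
    N15At { I := TGIndexS × Fin (d + 1), c35 := c35, p := p, pi := fgInstanceV1GS d 𝔄 ι hL, Kop := fgFamilyV1XS d 𝔄 ι e hL b,
            Ksite := v1SiteS d 𝔄 ι hL aS, Kunit := v1CovS d 𝔄 ι hL α β, inΛ := fun _ _ => True, unitDist := fun j => (fgInstanceV1GS d 𝔄 ι hL j).gc.dist } :=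
  n15At_opGeoS_of_ne2PlusOperator (d := d) hL (fun j : TGIndexS × Fin (d + 1) => j.1.toTGIndex) (fun j => j.1.Msz)
    (fun j => (Tor (fine (L ^ j.1.k) (TGIndex.Mn d hL j.1.toTGIndex)) × Fin (d + 1)) × ι)
    (fun j => liftBlk (blkFine L j.1.k (TGIndex.Mn d hL j.1.toTGIndex)) ι)
    (fun j => (fgInstanceV1GS d 𝔄 ι hL j).gf) (fun j => (fgInstanceV1GS d 𝔄 ι hL j).Bc) (fun j => (fgInstanceV1GS d 𝔄 ι hL j).Bf)
    hd hLodd hL2 haS α β (fun j => j.1.one_le_mT) (fun j => (fgInstanceV1GS d 𝔄 ι hL j).pair) p (fgFamilyV1XS d 𝔄 ι e hL b)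
    (ne2PlusOperator_fullGM₂_v1XS d 𝔄 ι e hd hLodd hL2 hL hb c35 hc35)

/-- ★★★ the same for the family WITH COVARIANT ENTRIES 1, 3 (`v1XC`, FILE 40 `ne2PlusOperator_fullGM₂_v1XCS`). [bookkeeping] -/
theorem n15At_v1XCS (hd : 1 ≤ d) (hLodd : Odd L) (hL2 : 2 ≤ L) (hL : Odd L ∧ 1 < L) {b aS c35 : ℝ} (hb : 0 < b) (haS : 0 < aS) (hc35 : 0 < c35)
    (α β : Fin (d + 1)) (p : ℝ) :
    N15At { I := TGIndexS × Fin (d + 1), c35 := c35, p := p, pi := fgInstanceV1GS d 𝔄 ι hL, Kop := fgFamilyV1XCS d 𝔄 ι e hL b,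
            Ksite := v1SiteS d 𝔄 ι hL aS, Kunit := v1CovS d 𝔄 ι hL α β, inΛ := fun _ _ => True, unitDist := fun j => (fgInstanceV1GS d 𝔄 ι hL j).gc.dist } :=
  n15At_opGeoS_of_ne2PlusOperator (d := d) hL (fun j : TGIndexS × Fin (d + 1) => j.1.toTGIndex) (fun j => j.1.Msz)
    (fun j => (Tor (fine (L ^ j.1.k) (TGIndex.Mn d hL j.1.toTGIndex)) × Fin (d + 1)) × ι)
    (fun j => liftBlk (blkFine L j.1.k (TGIndex.Mn d hL j.1.toTGIndex)) ι)
    (fun j => (fgInstanceV1GS d 𝔄 ι hL j).gf) (fun j => (fgInstanceV1GS d 𝔄 ι hL j).Bc) (fun j => (fgInstanceV1GS d 𝔄 ι hL j).Bf)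
    hd hLodd hL2 haS α β (fun j => j.1.one_le_mT) (fun j => (fgInstanceV1GS d 𝔄 ι hL j).pair) p (fgFamilyV1XCS d 𝔄 ι e hL b)
    (ne2PlusOperator_fullGM₂_v1XCS d 𝔄 ι e hd hLodd hL2 hL hb c35 hc35)

/-- ★★★ the same for the family WITH ALL FOUR ENTRIES COVARIANT (`v1XA`, FILE 40 `ne2PlusOperator_fullGM₂_v1XAS`) — the most genuine operator layer of the lineage. [bookkeeping] -/
theorem n15At_v1XAS (hd : 1 ≤ d) (hLodd : Odd L) (hL2 : 2 ≤ L) (hL : Odd L ∧ 1 < L) {b aS c35 : ℝ} (hb : 0 < b) (haS : 0 < aS) (hc35 : 0 < c35)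
    (α β : Fin (d + 1)) (p : ℝ) :
    N15At { I := TGIndexS × Fin (d + 1), c35 := c35, p := p, pi := fgInstanceV1GS d 𝔄 ι hL, Kop := fgFamilyV1XAS d 𝔄 ι e hL b,
            Ksite := v1SiteS d 𝔄 ι hL aS, Kunit := v1CovS d 𝔄 ι hL α β, inΛ := fun _ _ => True, unitDist := fun j => (fgInstanceV1GS d 𝔄 ι hL j).gc.dist } :=
  n15At_opGeoS_of_ne2PlusOperator (d := d) hL (fun j : TGIndexS × Fin (d + 1) => j.1.toTGIndex) (fun j => j.1.Msz)
    (fun j => (Tor (fine (L ^ j.1.k) (TGIndex.Mn d hL j.1.toTGIndex)) × Fin (d + 1)) × ι)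
    (fun j => liftBlk (blkFine L j.1.k (TGIndex.Mn d hL j.1.toTGIndex)) ι)
    (fun j => (fgInstanceV1GS d 𝔄 ι hL j).gf) (fun j => (fgInstanceV1GS d 𝔄 ι hL j).Bc) (fun j => (fgInstanceV1GS d 𝔄 ι hL j).Bf)
    hd hLodd hL2 haS α β (fun j => j.1.one_le_mT) (fun j => (fgInstanceV1GS d 𝔄 ι hL j).pair) p (fgFamilyV1XAS d 𝔄 ι e hL b)
    (ne2PlusOperator_fullGM₂_v1XAS d 𝔄 ι e hd hLodd hL2 hL hb c35 hc35)

/-! ## §3 The family passes the guard; guard ∧ estimate together -/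

omit [CompleteSpace 𝔄] [DecidableEq ι] [Nonempty ι] in
/-- ★★ **FILE 40's SIZED CARRIER PASSES THE K3⁷ v2 GUARD FOR ANY KERNELS** (w2's `PairedFamilyGuard.Live` BY NAME; `c₃₅ ≥ 0`): jointly cofinal in `gf.M` and `gc.k`
(`cofinal_fst_tgIndexS`), the trivial gauge field regular at every `α₀ > 0` (§1), the unit-lattice region `⊤` met — through the socket's `live_opGeoS`. [bookkeeping] -/
theorem live_fgInstanceV1GS (hL : Odd L ∧ 1 < L) {c35 : ℝ} (hc35 : 0 ≤ c35) (p : ℝ)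
    (Kop : ∀ j, B9.KernelFamily (fgInstanceV1GS d 𝔄 ι hL j).gc (fgInstanceV1GS d 𝔄 ι hL j).Bf)
    (Ksite Kunit : ∀ j, B9.SiteKernel (fgInstanceV1GS d 𝔄 ι hL j).gc (fgInstanceV1GS d 𝔄 ι hL j).Bf) :
    Live ⟨TGIndexS × Fin (d + 1), c35, p, fgInstanceV1GS d 𝔄 ι hL, Kop, Ksite, Kunit, fun _ _ => True, fun j => (fgInstanceV1GS d 𝔄 ι hL j).gc.dist⟩ :=
  live_opGeoS (d := d) hL (fun j : TGIndexS × Fin (d + 1) => j.1.toTGIndex) (fun j => j.1.Msz)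
    (fun j => (Tor (fine (L ^ j.1.k) (TGIndex.Mn d hL j.1.toTGIndex)) × Fin (d + 1)) × ι)
    (fun j => liftBlk (blkFine L j.1.k (TGIndex.Mn d hL j.1.toTGIndex)) ι)
    (fun j => (fgInstanceV1GS d 𝔄 ι hL j).gf) (fun j => (fgInstanceV1GS d 𝔄 ι hL j).Bc) (fun j => (fgInstanceV1GS d 𝔄 ι hL j).Bf)
    (fun j => (fgInstanceV1GS d 𝔄 ι hL j).pair) c35 p Kop Ksite Kunit cofinal_fst_tgIndexS
    (fun j α₀ hα₀ => reg_zero_fgInstanceV1GS d 𝔄 ι hL hc35 j α₀ hα₀)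

/-- ★★★ **GUARD ∧ `N15At` — THE BEST N15 INHABITANT IN THE TREE** (`v1XA`: all four (3.42) entries covariant; `d ≥ 1`, odd `L ≥ 3`, `b, a_S, c₃₅ > 0`): the family is LIVE (size and
scale count cofinal, regular trivial field) AND carries `N15At`, its operator layer reading the background `A′` and the size `M` SUBSTANTIVELY (window `C·M·α₀`); site∕unit U-blind.
[bookkeeping] -/
theorem live_and_n15At_v1XAS (hd : 1 ≤ d) (hLodd : Odd L) (hL2 : 2 ≤ L) (hL : Odd L ∧ 1 < L) {b aS c35 : ℝ} (hb : 0 < b) (haS : 0 < aS) (hc35 : 0 < c35)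
    (α β : Fin (d + 1)) (p : ℝ) :
    Live ⟨TGIndexS × Fin (d + 1), c35, p, fgInstanceV1GS d 𝔄 ι hL, fgFamilyV1XAS d 𝔄 ι e hL b, v1SiteS d 𝔄 ι hL aS, v1CovS d 𝔄 ι hL α β, fun _ _ => True,
        fun j => (fgInstanceV1GS d 𝔄 ι hL j).gc.dist⟩ ∧
      N15At { I := TGIndexS × Fin (d + 1), c35 := c35, p := p, pi := fgInstanceV1GS d 𝔄 ι hL, Kop := fgFamilyV1XAS d 𝔄 ι e hL b,
              Ksite := v1SiteS d 𝔄 ι hL aS, Kunit := v1CovS d 𝔄 ι hL α β, inΛ := fun _ _ => True, unitDist := fun j => (fgInstanceV1GS d 𝔄 ι hL j).gc.dist } :=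
  ⟨live_fgInstanceV1GS 𝔄 ι hL hc35.le p _ _ _, n15At_v1XAS 𝔄 ι e hd hLodd hL2 hL hb haS hc35 α β p⟩

/-- ★★ the same pair for the exact-species by-parts family `v1X`. [bookkeeping] -/
theorem live_and_n15At_v1XS (hd : 1 ≤ d) (hLodd : Odd L) (hL2 : 2 ≤ L) (hL : Odd L ∧ 1 < L) {b aS c35 : ℝ} (hb : 0 < b) (haS : 0 < aS) (hc35 : 0 < c35)
    (α β : Fin (d + 1)) (p : ℝ) :
    Live ⟨TGIndexS × Fin (d + 1), c35, p, fgInstanceV1GS d 𝔄 ι hL, fgFamilyV1XS d 𝔄 ι e hL b, v1SiteS d 𝔄 ι hL aS, v1CovS d 𝔄 ι hL α β, fun _ _ => True,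
        fun j => (fgInstanceV1GS d 𝔄 ι hL j).gc.dist⟩ ∧
      N15At { I := TGIndexS × Fin (d + 1), c35 := c35, p := p, pi := fgInstanceV1GS d 𝔄 ι hL, Kop := fgFamilyV1XS d 𝔄 ι e hL b,
              Ksite := v1SiteS d 𝔄 ι hL aS, Kunit := v1CovS d 𝔄 ι hL α β, inΛ := fun _ _ => True, unitDist := fun j => (fgInstanceV1GS d 𝔄 ι hL j).gc.dist } :=
  ⟨live_fgInstanceV1GS 𝔄 ι hL hc35.le p _ _ _, n15At_v1XS 𝔄 ι e hd hLodd hL2 hL hb haS hc35 α β p⟩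

end Knit

/-! ## §4 The `v1XA` family as N15's `NE2Objects₁₁` literal; keyed-home faces -/

section Record

/-- **N15's NE2 OBJECTS OF THE SIZED GAUGE-DRESSED `v1XA` FAMILY** (RR-1's layer-A container): index `TGIndexS × Fin (d+1)` (torus of record × size `M` × direction), letters `c₃₅`, `p`,
FILE 40's sized instances, OPERATOR kernels `fgFamilyV1XAS b` (all four (3.42) entries covariant, background LIVE), SITE `v1SiteS a_S`, UNIT `v1CovS α β`, region `⊤`, the carrier's
distance. [bookkeeping] -/
def v1XASObjects (hL : Odd L ∧ 1 < L) (b aS : ℝ) (α β : Fin (d + 1)) (c35 p : ℝ) : NE2Objects₁₁ where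
  I := TGIndexS × Fin (d + 1)
  c35 := c35
  p := p
  pi := fgInstanceV1GS d 𝔄 ι hL
  Kop := fgFamilyV1XAS d 𝔄 ι e hL b
  Ksite := v1SiteS d 𝔄 ι hL aS
  Kunit := v1CovS d 𝔄 ι hL α β
  inΛ := fun _ _ => True
  unitDist := fun j => (fgInstanceV1GS d 𝔄 ι hL j).gc.dist

variable {d}

/-- ★★★ **`Live ∧ N15At` AT THE OBJECTS' BUNDLE — OUTRIGHT** (`d ≥ 1`, odd `L ≥ 3`, `b, a_S, c₃₅ > 0`). [bookkeeping] -/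
theorem live_and_n15At_v1XASObjects (hd : 1 ≤ d) (hLodd : Odd L) (hL2 : 2 ≤ L) (hL : Odd L ∧ 1 < L) {b aS c35 : ℝ} (hb : 0 < b) (haS : 0 < aS) (hc35 : 0 < c35)
    (α β : Fin (d + 1)) (p : ℝ) :
    Live (ne2OfRecord₁₁ (v1XASObjects d 𝔄 ι e hL b aS α β c35 p)) ∧ N15At (ne2OfRecord₁₁ (v1XASObjects d 𝔄 ι e hL b aS α β c35 p)) :=
  live_and_n15At_v1XAS 𝔄 ι e hd hLodd hL2 hL hb haS hc35 α β p

/-- `N15At` alone at the bundle. [bookkeeping] -/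
theorem n15At_v1XASObjects (hd : 1 ≤ d) (hLodd : Odd L) (hL2 : 2 ≤ L) (hL : Odd L ∧ 1 < L) {b aS c35 : ℝ} (hb : 0 < b) (haS : 0 < aS) (hc35 : 0 < c35)
    (α β : Fin (d + 1)) (p : ℝ) : N15At (ne2OfRecord₁₁ (v1XASObjects d 𝔄 ι e hL b aS α β c35 p)) :=
  (live_and_n15At_v1XASObjects 𝔄 ι e hd hLodd hL2 hL hb haS hc35 α β p).2

omit [CompleteSpace 𝔄] [Nonempty ι] in
/-- `Live` alone at the bundle (`c₃₅ ≥ 0`, every other parameter). [bookkeeping] -/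
theorem live_v1XASObjects (hL : Odd L ∧ 1 < L) (b aS : ℝ) (α β : Fin (d + 1)) {c35 : ℝ} (hc35 : 0 ≤ c35) (p : ℝ) :
    Live (ne2OfRecord₁₁ (v1XASObjects d 𝔄 ι e hL b aS α β c35 p)) :=
  live_fgInstanceV1GS 𝔄 ι hL hc35 p _ _ _

omit [CompleteSpace 𝔄] [Nonempty ι] in
/-- RR-1's display: the objects are `Populated`. [bookkeeping] -/
theorem populated_v1XASObjects (hL : Odd L ∧ 1 < L) (b aS : ℝ) (α β : Fin (d + 1)) (c35 p : ℝ) : (v1XASObjects d 𝔄 ι e hL b aS α β c35 p).Populated :=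
  (NE2Objects₁₁.populated_iff _).2 (let ⟨j⟩ := tgIndexS_nonempty; ⟨(j, 0)⟩)

variable {N : ℕ} [NeZero N] {key : (F : T4Family) → Datum F N → Prop}

/-- ★★ **THE READING CLOSES THE STUB AT ANY KEYED HOME** (part 30's interface): `d ≥ 1`, odd `L ≥ 3`, `b, a_S, c₃₅ > 0`; a home admitting only the literals of a key-indexed NE2
reading whose value everywhere IS `v1XASObjects …` has `S_N15 RRec` — the estimate is §2, not a hypothesis. [bookkeeping] -/
theorem s_N15_of_admits_v1XAS (hd : 1 ≤ d) (hLodd : Odd L) (hL2 : 2 ≤ L) (hL : Odd L ∧ 1 < L) {b aS c35 : ℝ} (hb : 0 < b) (haS : 0 < aS) (hc35 : 0 < c35)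
    (α β : Fin (d + 1)) (p : ℝ)
    (ne2At : ∀ {F : T4Family} {D : Datum F N}, key F D → (ℕ → ℝ) → List (ULoop F) → ℕ → NE2Objects₁₁) (RRec : RateRecordPred N)
    (hadm : ∀ (F : T4Family) (D : Datum F N) (g₀ : ℕ → ℝ) (os : List (ULoop F)) (R : RateCarriers N), RRec F D g₀ os R →
      ∃ (h : key F D) (k : ℕ), R.ne2 = ne2OfRecord₁₁ (ne2At h g₀ os k))
    (h : ∀ (F : T4Family) (D : Datum F N) (h : key F D) (g₀ : ℕ → ℝ) (os : List (ULoop F)) (k : ℕ), ne2At h g₀ os k = v1XASObjects d 𝔄 ι e hL b aS α β c35 p) :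
    S_N15 RRec := by
  refine s_N15_of_admits ne2At RRec hadm fun F D hk g₀ os k => ?_
  rw [h F D hk g₀ os k]
  exact n15At_v1XASObjects 𝔄 ι e hd hLodd hL2 hL hb haS hc35 α β p

/-- `Live ∧ N15At` at the family-keyed literal (`d + 1 = 4`, the datum's own block factor `F.L`; `2 ≤ F.L` from `11 < L`). [bookkeeping] -/
theorem live_and_n15At_v1XASObjects_family {b aS c35 : ℝ} (hb : 0 < b) (haS : 0 < aS) (hc35 : 0 < c35) (α β : Fin 4) (p : ℝ) (F : T4Family) :
    Live (ne2OfRecord₁₁ (haveI := neZero_blockFactor F; v1XASObjects 3 𝔄 ι e F.hL b aS α β c35 p)) ∧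
      N15At (ne2OfRecord₁₁ (haveI := neZero_blockFactor F; v1XASObjects 3 𝔄 ι e F.hL b aS α β c35 p)) := by
  haveI := neZero_blockFactor F
  exact live_and_n15At_v1XASObjects (d := 3) 𝔄 ι e (by norm_num) F.hL.1 (two_le_L F) F.hL hb haS hc35 α β p

/-- ★★ **THE FAMILY-KEYED READING CLOSES THE STUB AT ANY KEYED HOME** (`d + 1 = 4`; the reading reads the datum's own family). [bookkeeping] -/
theorem s_N15_of_admits_v1XAS_family {b aS c35 : ℝ} (hb : 0 < b) (haS : 0 < aS) (hc35 : 0 < c35) (α β : Fin 4) (p : ℝ)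
    (ne2At : ∀ {F : T4Family} {D : Datum F N}, key F D → (ℕ → ℝ) → List (ULoop F) → ℕ → NE2Objects₁₁) (RRec : RateRecordPred N)
    (hadm : ∀ (F : T4Family) (D : Datum F N) (g₀ : ℕ → ℝ) (os : List (ULoop F)) (R : RateCarriers N), RRec F D g₀ os R →
      ∃ (h : key F D) (k : ℕ), R.ne2 = ne2OfRecord₁₁ (ne2At h g₀ os k))
    (h : ∀ (F : T4Family) (D : Datum F N) (h : key F D) (g₀ : ℕ → ℝ) (os : List (ULoop F)) (k : ℕ),
      ne2At h g₀ os k = haveI := neZero_blockFactor F; v1XASObjects 3 𝔄 ι e F.hL b aS α β c35 p) :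
    S_N15 RRec := by
  refine s_N15_of_admits ne2At RRec hadm fun F D hk g₀ os k => ?_
  rw [h F D hk g₀ os k]
  exact (live_and_n15At_v1XASObjects_family 𝔄 ι e hb haS hc35 α β p F).2

omit [CompleteSpace 𝔄] [Nonempty ι] in
/-- RR-1's display at the family-keyed literal. [bookkeeping] -/
theorem populated_v1XASObjects_family (F : T4Family) (b aS : ℝ) (α β : Fin 4) (c35 p : ℝ) :
    (haveI := neZero_blockFactor F; v1XASObjects 3 𝔄 ι e F.hL b aS α β c35 p).Populated := by
  haveI := neZero_blockFactor F
  exact populated_v1XASObjects 𝔄 ι e F.hL b aS α β c35 p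

end Record

end Summit.QuantumFields.YangMills.BalabanUVNodes.N15.GenuineRecord

end
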